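/-
Copyright: the b2b-balaban T⁴-continuum CRUX team, row NE7b OWNER lineage `t4-ne7b-p1` (gen 143). Project licence.
-/
import Summits.QuantumFields.BalabanUV.T4Continuum.Spine.NE7b.SupTiltedCumulantCalculusOne

/-!
# LINE DERIVATIVES OF THE TILTED MEANS OF PRODUCTS, E-FORM (SCOPING (d15); (581)'s RULE 1 `hasDerivAt_tilted_mean_line` for products,
# PRE-SPLIT; companion of (586)).  For observables `p, q, r, w` of (513)'s growth class, along `ψ_s = ψ₀ + s·n` with `A = U′(·)n` and `m_S =
# Z⁻¹∫eΠ_S`:  `d∕ds m_{pq} = Z⁻¹(∫e(∂p)q + ∫e p(∂q)) − (Z⁻¹∫e pqA − Z⁻²∫e pq·∫eA)`, and likewise for `pqr` and `pqrw` — the normalised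
# inputs by which cumulant rule 4 closes by `ring` without clearing denominators (row NE7b, node U5c; (581) `hasDerivAt_tilted_mean_line`,
# `class_mul_abs_le`, `class_mul_fderiv_le`, `class_mul_fderiv_continuous`, `class_apply_abs_le`, (518) `integrable_tilted_of_growth` BY NAME;
# [folklore])

Cell `pub-balaban`, sub-cell `t4`, spine estimate NE7b (`T4WeightBudget.RelWeightBound`; the cell's OWN estimate — NOT PRINTED in
[Bałaban 1983–89], NOT PROVED).  Crux-route work under `Spine/NE7b/` by the row OWNER (`t4-ne7b-p1` gen 143, file (588)) under FREEZE
(0)'s crux-prover clause; NOTHING of Bałaban's is named as a Lean object, valued or asserted; no `T4Continuum/Support` leaf typed; no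
`def`, no notation; zero `sorry`.  Imports (BY NAME): the OWNER's (581) `…SupTiltedCumulantCalculusOne` (through it (513), (518), (516)).

WHAT IS PROVED ([folklore]): **`hasDerivAt_mean_line_two`**, **`hasDerivAt_mean_line_three`**, **`hasDerivAt_mean_line_four`**; toy.

HONEST (what this is NOT).  Calculus bookkeeping only.  Scalar skeleton ((A3), NC-NE7b-α UNRULED); nothing of Bałaban's asserted.  BY-NAME EFFECT
ON THE WALL: NONE.  NE7b NOT PRINTED ∕ NOT PROVED; spine PROVED 0∕9; rung (B)+1 — the programme's measures remain FINITE-torus statements; NOT the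
mass gap, NOT Clay.  HONEST DEPENDENCY: continuum YM on T⁴ ⇐ BetaPertH ∧ nine spine estimates (0∕9 proved); BetaPertH ⇐ (D1) ∧ (D4) ∧ CAP+tail;
G-an2-4 gates asym, D1 and NE2∕3∕4.
-/

set_option autoImplicit false
set_option maxSynthPendingDepth 3

noncomputable section

namespace Summit.QuantumFields.BalabanUV.T4Continuum.NE7b.SupTiltedProductMeanLines

open MeasureTheory ProbabilityTheory Real Set Function Finset Matrix
open scoped BigOperators
open SupFourthOrderMonomials (integrable_tilted_of_growth)
open SupTiltedCumulantCalculusOne (class_mul_abs_le class_mul_fderiv_le class_mul_fderiv_continuous class_apply_abs_le hasDerivAt_tilted_mean_line)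

variable {ι : Type} [Fintype ι] [DecidableEq ι]

variable {Γ : Matrix ι ι ℝ} {γop : ℝ} {U : EuclideanSpace ℝ ι → ℝ} {U' : EuclideanSpace ℝ ι → EuclideanSpace ℝ ι →L[ℝ] ℝ}
  {U'' : EuclideanSpace ℝ ι → EuclideanSpace ℝ ι →L[ℝ] EuclideanSpace ℝ ι →L[ℝ] ℝ} {κ₀ κ₁ κ₂ a τ δ θ : ℝ}
  {p q r w : EuclideanSpace ℝ ι → ℝ} {p' q' r' w' : EuclideanSpace ℝ ι → EuclideanSpace ℝ ι →L[ℝ] ℝ} {Cp Cq Cr Cw : ℝ} {np nq nr nw : ℕ}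

/-- **`d∕ds m_{pq} = Z⁻¹(∫e(∂p)q + ∫e p(∂q)) − (Z⁻¹∫e pqA − Z⁻²∫e pq·∫eA)`** along `ψ_s = ψ₀ + s·n`. [folklore] -/
theorem hasDerivAt_mean_line_two (hΓ : Γ.PosSemidef) (hΓop : (γop • (1 : Matrix ι ι ℝ) - Γ).PosSemidef) (Y : Finset ι)
    (hUd : ∀ φ : EuclideanSpace ℝ ι, HasFDerivAt U (U' φ) φ) (hU'd : ∀ φ : EuclideanSpace ℝ ι, HasFDerivAt U' (U'' φ) φ)
    (hκ₀ : 0 ≤ κ₀) (hκ₁ : 0 ≤ κ₁) (ha : 0 ≤ a) (hτ : 0 < τ) (hδ : 0 < δ) (hθ0 : 0 < θ) (hθ1 : θ < 1) (hκθ : (2 * κ₀ * (1 + τ) + 4 * δ) * γop ≤ θ)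
    (hstab : ∀ φ : EuclideanSpace ℝ ι, -(κ₀ * ∑ x ∈ Y, φ x ^ 2) ≤ U φ) (hU'b : ∀ φ : EuclideanSpace ℝ ι, ‖U' φ‖ ≤ κ₁ * (a + ∑ x ∈ Y, φ x ^ 2))
    (hU''b : ∀ φ : EuclideanSpace ℝ ι, ‖U'' φ‖ ≤ κ₂)
    (hp : ∀ φ : EuclideanSpace ℝ ι, HasFDerivAt p (p' φ) φ) (hp'c : Continuous p') (hpb : ∀ φ : EuclideanSpace ℝ ι, |p φ| ≤ Cp * (1 + ‖U' φ‖) ^ np)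
    (hp'b : ∀ φ : EuclideanSpace ℝ ι, ‖p' φ‖ ≤ Cp * (1 + ‖U' φ‖) ^ np)
    (hq : ∀ φ : EuclideanSpace ℝ ι, HasFDerivAt q (q' φ) φ) (hq'c : Continuous q') (hqb : ∀ φ : EuclideanSpace ℝ ι, |q φ| ≤ Cq * (1 + ‖U' φ‖) ^ nq)
    (hq'b : ∀ φ : EuclideanSpace ℝ ι, ‖q' φ‖ ≤ Cq * (1 + ‖U' φ‖) ^ nq)
    (ψ₀ n : EuclideanSpace ℝ ι) :
    HasDerivAt (fun s : ℝ => (∫ ω : EuclideanSpace ℝ ι, exp (-U (ω + (ψ₀ + s • n))) ∂(multivariateGaussian 0 Γ))⁻¹ * (∫ ω : EuclideanSpace ℝ ι, exp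
        (-U (ω + (ψ₀ + s • n))) * (p (ω + (ψ₀ + s • n)) * q (ω + (ψ₀ + s • n))) ∂(multivariateGaussian 0 Γ)))
      ((∫ ω : EuclideanSpace ℝ ι, exp (-U (ω + ψ₀)) ∂(multivariateGaussian 0 Γ))⁻¹ *
        ((∫ ω : EuclideanSpace ℝ ι, exp (-U (ω + ψ₀)) * (p' (ω + ψ₀) n * q (ω + ψ₀)) ∂(multivariateGaussian 0 Γ)) +
          (∫ ω : EuclideanSpace ℝ ι, exp (-U (ω + ψ₀)) * (p (ω + ψ₀) * q' (ω + ψ₀) n) ∂(multivariateGaussian 0 Γ))) -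
        ((∫ ω : EuclideanSpace ℝ ι, exp (-U (ω + ψ₀)) ∂(multivariateGaussian 0 Γ))⁻¹ * (∫ ω : EuclideanSpace ℝ ι, exp (-U (ω + ψ₀)) * (p (ω + ψ₀) * q
            (ω + ψ₀) * U' (ω + ψ₀) n) ∂(multivariateGaussian 0 Γ)) -
          ((∫ ω : EuclideanSpace ℝ ι, exp (-U (ω + ψ₀)) ∂(multivariateGaussian 0 Γ)) ^ 2)⁻¹ * ((∫ ω : EuclideanSpace ℝ ι, exp (-U (ω + ψ₀)) * (p (ω +
              ψ₀) * q (ω + ψ₀)) ∂(multivariateGaussian 0 Γ)) * (∫ ω : EuclideanSpace ℝ ι, exp (-U (ω + ψ₀)) * U' (ω + ψ₀) n ∂(multivariateGaussian 0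
              Γ))))) 0 := by
  have hpc : Continuous p := continuous_iff_continuousAt.2 fun φ => (hp φ).continuousAt
  have hqc : Continuous q := continuous_iff_continuousAt.2 fun φ => (hq φ).continuousAt
  have hM := hasDerivAt_tilted_mean_line (p := fun φ => p φ * q φ) (p' := fun φ => p φ • q' φ + q φ • p' φ)
    (Cp := 2 * Cp * Cq) (np := np + nq) hΓ hΓop Y hUd hU'd hκ₀ hκ₁ ha hτ hδ hθ0 hθ1 hκθ hstab hU'b hU''b (fun φ => ((hp φ).mul (hq φ)))
    (class_mul_fderiv_continuous hp hp'c hq hq'c)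
    (fun φ => class_mul_abs_le hpb hqb φ)
    (fun φ => class_mul_fderiv_le hpb hp'b hqb hq'b φ) ψ₀ n
  have i_pdq := integrable_tilted_of_growth (p := fun φ => p' φ n * q φ) hΓ hΓop Y hUd ((hp'c.clm_apply continuous_const).mul hqc) hκ₀ hκ₁ ha hτ hδ
      hθ1 hκθ hstab hU'b
    (fun φ => class_mul_abs_le (fun φ => class_apply_abs_le hp'b φ n) hqb φ) ψ₀
  have i_pqd := integrable_tilted_of_growth (p := fun φ => p φ * q' φ n) hΓ hΓop Y hUd (hpc.mul (hq'c.clm_apply continuous_const)) hκ₀ hκ₁ ha hτ hδ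
      hθ1 hκθ hstab hU'b
    (fun φ => class_mul_abs_le hpb (fun φ => class_apply_abs_le hq'b φ n) φ) ψ₀
  have esplit : (∫ ω : EuclideanSpace ℝ ι, exp (-U (ω + ψ₀)) * (p (ω + ψ₀) • q' (ω + ψ₀) + q (ω + ψ₀) • p' (ω + ψ₀)) n ∂(multivariateGaussian 0 Γ)) =
      (∫ ω : EuclideanSpace ℝ ι, exp (-U (ω + ψ₀)) * (p' (ω + ψ₀) n * q (ω + ψ₀)) ∂(multivariateGaussian 0 Γ)) +
        (∫ ω : EuclideanSpace ℝ ι, exp (-U (ω + ψ₀)) * (p (ω + ψ₀) * q' (ω + ψ₀) n) ∂(multivariateGaussian 0 Γ)) := by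
    rw [← integral_add i_pdq i_pqd]
    exact integral_congr_ae (ae_of_all _ fun ω => by simp only [_root_.add_apply, _root_.smul_apply, smul_eq_mul]; ring)
  rw [esplit] at hM
  exact hM

/-- **`d∕ds m_{pqr}`**: three split derivative moments, minus the raw covariance with `A`. [folklore] -/
theorem hasDerivAt_mean_line_three (hΓ : Γ.PosSemidef) (hΓop : (γop • (1 : Matrix ι ι ℝ) - Γ).PosSemidef) (Y : Finset ι)
    (hUd : ∀ φ : EuclideanSpace ℝ ι, HasFDerivAt U (U' φ) φ) (hU'd : ∀ φ : EuclideanSpace ℝ ι, HasFDerivAt U' (U'' φ) φ)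
    (hκ₀ : 0 ≤ κ₀) (hκ₁ : 0 ≤ κ₁) (ha : 0 ≤ a) (hτ : 0 < τ) (hδ : 0 < δ) (hθ0 : 0 < θ) (hθ1 : θ < 1) (hκθ : (2 * κ₀ * (1 + τ) + 4 * δ) * γop ≤ θ)
    (hstab : ∀ φ : EuclideanSpace ℝ ι, -(κ₀ * ∑ x ∈ Y, φ x ^ 2) ≤ U φ) (hU'b : ∀ φ : EuclideanSpace ℝ ι, ‖U' φ‖ ≤ κ₁ * (a + ∑ x ∈ Y, φ x ^ 2))
    (hU''b : ∀ φ : EuclideanSpace ℝ ι, ‖U'' φ‖ ≤ κ₂)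
    (hp : ∀ φ : EuclideanSpace ℝ ι, HasFDerivAt p (p' φ) φ) (hp'c : Continuous p') (hpb : ∀ φ : EuclideanSpace ℝ ι, |p φ| ≤ Cp * (1 + ‖U' φ‖) ^ np)
    (hp'b : ∀ φ : EuclideanSpace ℝ ι, ‖p' φ‖ ≤ Cp * (1 + ‖U' φ‖) ^ np)
    (hq : ∀ φ : EuclideanSpace ℝ ι, HasFDerivAt q (q' φ) φ) (hq'c : Continuous q') (hqb : ∀ φ : EuclideanSpace ℝ ι, |q φ| ≤ Cq * (1 + ‖U' φ‖) ^ nq)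
    (hq'b : ∀ φ : EuclideanSpace ℝ ι, ‖q' φ‖ ≤ Cq * (1 + ‖U' φ‖) ^ nq)
    (hr : ∀ φ : EuclideanSpace ℝ ι, HasFDerivAt r (r' φ) φ) (hr'c : Continuous r') (hrb : ∀ φ : EuclideanSpace ℝ ι, |r φ| ≤ Cr * (1 + ‖U' φ‖) ^ nr)
    (hr'b : ∀ φ : EuclideanSpace ℝ ι, ‖r' φ‖ ≤ Cr * (1 + ‖U' φ‖) ^ nr)
    (ψ₀ n : EuclideanSpace ℝ ι) :
    HasDerivAt (fun s : ℝ => (∫ ω : EuclideanSpace ℝ ι, exp (-U (ω + (ψ₀ + s • n))) ∂(multivariateGaussian 0 Γ))⁻¹ * (∫ ω : EuclideanSpace ℝ ι, exp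
        (-U (ω + (ψ₀ + s • n))) * (p (ω + (ψ₀ + s • n)) * q (ω + (ψ₀ + s • n)) * r (ω + (ψ₀ + s • n))) ∂(multivariateGaussian 0 Γ)))
      ((∫ ω : EuclideanSpace ℝ ι, exp (-U (ω + ψ₀)) ∂(multivariateGaussian 0 Γ))⁻¹ *
        ((∫ ω : EuclideanSpace ℝ ι, exp (-U (ω + ψ₀)) * (p' (ω + ψ₀) n * q (ω + ψ₀) * r (ω + ψ₀)) ∂(multivariateGaussian 0 Γ)) +
          (∫ ω : EuclideanSpace ℝ ι, exp (-U (ω + ψ₀)) * (p (ω + ψ₀) * q' (ω + ψ₀) n * r (ω + ψ₀)) ∂(multivariateGaussian 0 Γ)) +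
          (∫ ω : EuclideanSpace ℝ ι, exp (-U (ω + ψ₀)) * (p (ω + ψ₀) * q (ω + ψ₀) * r' (ω + ψ₀) n) ∂(multivariateGaussian 0 Γ))) -
        ((∫ ω : EuclideanSpace ℝ ι, exp (-U (ω + ψ₀)) ∂(multivariateGaussian 0 Γ))⁻¹ * (∫ ω : EuclideanSpace ℝ ι, exp (-U (ω + ψ₀)) * (p (ω + ψ₀) * q
            (ω + ψ₀) * r (ω + ψ₀) * U' (ω + ψ₀) n) ∂(multivariateGaussian 0 Γ)) -
          ((∫ ω : EuclideanSpace ℝ ι, exp (-U (ω + ψ₀)) ∂(multivariateGaussian 0 Γ)) ^ 2)⁻¹ * ((∫ ω : EuclideanSpace ℝ ι, exp (-U (ω + ψ₀)) * (p (ω +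
              ψ₀) * q (ω + ψ₀) * r (ω + ψ₀)) ∂(multivariateGaussian 0 Γ)) * (∫ ω : EuclideanSpace ℝ ι, exp (-U (ω + ψ₀)) * U' (ω + ψ₀) n
              ∂(multivariateGaussian 0 Γ))))) 0 := by
  have hpc : Continuous p := continuous_iff_continuousAt.2 fun φ => (hp φ).continuousAt
  have hqc : Continuous q := continuous_iff_continuousAt.2 fun φ => (hq φ).continuousAt
  have hrc : Continuous r := continuous_iff_continuousAt.2 fun φ => (hr φ).continuousAt
  have hM := hasDerivAt_tilted_mean_line (p := fun φ => p φ * q φ * r φ) (p' := fun φ => (p φ * q φ) • r' φ + r φ • (p φ • q' φ + q φ • p' φ))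
    (Cp := 2 * (2 * Cp * Cq) * Cr) (np := np + nq + nr) hΓ hΓop Y hUd hU'd hκ₀ hκ₁ ha hτ hδ hθ0 hθ1 hκθ hstab hU'b hU''b (fun φ => (((hp φ).mul (hq
        φ)).mul (hr φ)))
    ((((hpc.mul hqc)).smul hr'c).add (hrc.smul (class_mul_fderiv_continuous hp hp'c hq hq'c)))
    (fun φ => class_mul_abs_le (fun φ => class_mul_abs_le hpb hqb φ) hrb φ)
    (fun φ => class_mul_fderiv_le (p := fun φ => p φ * q φ) (p' := fun φ => p φ • q' φ + q φ • p' φ) (fun φ => class_mul_abs_le hpb hqb φ)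
      (fun φ => class_mul_fderiv_le hpb hp'b hqb hq'b φ) hrb hr'b φ) ψ₀ n
  have i_pdqr := integrable_tilted_of_growth (p := fun φ => p' φ n * q φ * r φ) hΓ hΓop Y hUd (((hp'c.clm_apply continuous_const).mul hqc).mul hrc)
      hκ₀ hκ₁ ha hτ hδ hθ1 hκθ hstab hU'b
    (fun φ => class_mul_abs_le (fun φ => class_mul_abs_le (fun φ => class_apply_abs_le hp'b φ n) hqb φ) hrb φ) ψ₀
  have i_pqdr := integrable_tilted_of_growth (p := fun φ => p φ * q' φ n * r φ) hΓ hΓop Y hUd ((hpc.mul (hq'c.clm_apply continuous_const)).mul hrc)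
      hκ₀ hκ₁ ha hτ hδ hθ1 hκθ hstab hU'b
    (fun φ => class_mul_abs_le (fun φ => class_mul_abs_le hpb (fun φ => class_apply_abs_le hq'b φ n) φ) hrb φ) ψ₀
  have i_pqrd := integrable_tilted_of_growth (p := fun φ => p φ * q φ * r' φ n) hΓ hΓop Y hUd ((hpc.mul hqc).mul (hr'c.clm_apply continuous_const))
      hκ₀ hκ₁ ha hτ hδ hθ1 hκθ hstab hU'b
    (fun φ => class_mul_abs_le (fun φ => class_mul_abs_le hpb hqb φ) (fun φ => class_apply_abs_le hr'b φ n) φ) ψ₀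
  have is2 : Integrable (fun ω : EuclideanSpace ℝ ι => exp (-U (ω + ψ₀)) * (p' (ω + ψ₀) n * q (ω + ψ₀) * r (ω + ψ₀)) + exp (-U (ω + ψ₀)) * (p (ω +
      ψ₀) * q' (ω + ψ₀) n * r (ω + ψ₀))) (multivariateGaussian 0 Γ) := i_pdqr.add i_pqdr
  have esplit : (∫ ω : EuclideanSpace ℝ ι, exp (-U (ω + ψ₀)) * ((p (ω + ψ₀) * q (ω + ψ₀)) • r' (ω + ψ₀) + r (ω + ψ₀) • (p (ω + ψ₀) • q' (ω + ψ₀) + q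
      (ω + ψ₀) • p' (ω + ψ₀))) n ∂(multivariateGaussian 0 Γ)) =
      (∫ ω : EuclideanSpace ℝ ι, exp (-U (ω + ψ₀)) * (p' (ω + ψ₀) n * q (ω + ψ₀) * r (ω + ψ₀)) ∂(multivariateGaussian 0 Γ)) +
        (∫ ω : EuclideanSpace ℝ ι, exp (-U (ω + ψ₀)) * (p (ω + ψ₀) * q' (ω + ψ₀) n * r (ω + ψ₀)) ∂(multivariateGaussian 0 Γ)) +
        (∫ ω : EuclideanSpace ℝ ι, exp (-U (ω + ψ₀)) * (p (ω + ψ₀) * q (ω + ψ₀) * r' (ω + ψ₀) n) ∂(multivariateGaussian 0 Γ)) := by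
    rw [← integral_add i_pdqr i_pqdr, ← integral_add is2 i_pqrd]
    exact integral_congr_ae (ae_of_all _ fun ω => by simp only [_root_.add_apply, _root_.smul_apply, smul_eq_mul]; ring)
  rw [esplit] at hM
  exact hM

set_option maxHeartbeats 400000 in
/-- **`d∕ds m_{pqrw}`**: four split derivative moments, minus the raw covariance with `A`. [folklore] -/
theorem hasDerivAt_mean_line_four (hΓ : Γ.PosSemidef) (hΓop : (γop • (1 : Matrix ι ι ℝ) - Γ).PosSemidef) (Y : Finset ι)
    (hUd : ∀ φ : EuclideanSpace ℝ ι, HasFDerivAt U (U' φ) φ) (hU'd : ∀ φ : EuclideanSpace ℝ ι, HasFDerivAt U' (U'' φ) φ)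
    (hκ₀ : 0 ≤ κ₀) (hκ₁ : 0 ≤ κ₁) (ha : 0 ≤ a) (hτ : 0 < τ) (hδ : 0 < δ) (hθ0 : 0 < θ) (hθ1 : θ < 1) (hκθ : (2 * κ₀ * (1 + τ) + 4 * δ) * γop ≤ θ)
    (hstab : ∀ φ : EuclideanSpace ℝ ι, -(κ₀ * ∑ x ∈ Y, φ x ^ 2) ≤ U φ) (hU'b : ∀ φ : EuclideanSpace ℝ ι, ‖U' φ‖ ≤ κ₁ * (a + ∑ x ∈ Y, φ x ^ 2))
    (hU''b : ∀ φ : EuclideanSpace ℝ ι, ‖U'' φ‖ ≤ κ₂)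
    (hp : ∀ φ : EuclideanSpace ℝ ι, HasFDerivAt p (p' φ) φ) (hp'c : Continuous p') (hpb : ∀ φ : EuclideanSpace ℝ ι, |p φ| ≤ Cp * (1 + ‖U' φ‖) ^ np)
    (hp'b : ∀ φ : EuclideanSpace ℝ ι, ‖p' φ‖ ≤ Cp * (1 + ‖U' φ‖) ^ np)
    (hq : ∀ φ : EuclideanSpace ℝ ι, HasFDerivAt q (q' φ) φ) (hq'c : Continuous q') (hqb : ∀ φ : EuclideanSpace ℝ ι, |q φ| ≤ Cq * (1 + ‖U' φ‖) ^ nq)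
    (hq'b : ∀ φ : EuclideanSpace ℝ ι, ‖q' φ‖ ≤ Cq * (1 + ‖U' φ‖) ^ nq)
    (hr : ∀ φ : EuclideanSpace ℝ ι, HasFDerivAt r (r' φ) φ) (hr'c : Continuous r') (hrb : ∀ φ : EuclideanSpace ℝ ι, |r φ| ≤ Cr * (1 + ‖U' φ‖) ^ nr)
    (hr'b : ∀ φ : EuclideanSpace ℝ ι, ‖r' φ‖ ≤ Cr * (1 + ‖U' φ‖) ^ nr)
    (hw : ∀ φ : EuclideanSpace ℝ ι, HasFDerivAt w (w' φ) φ) (hw'c : Continuous w') (hwb : ∀ φ : EuclideanSpace ℝ ι, |w φ| ≤ Cw * (1 + ‖U' φ‖) ^ nw)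
    (hw'b : ∀ φ : EuclideanSpace ℝ ι, ‖w' φ‖ ≤ Cw * (1 + ‖U' φ‖) ^ nw)
    (ψ₀ n : EuclideanSpace ℝ ι) :
    HasDerivAt (fun s : ℝ => (∫ ω : EuclideanSpace ℝ ι, exp (-U (ω + (ψ₀ + s • n))) ∂(multivariateGaussian 0 Γ))⁻¹ * (∫ ω : EuclideanSpace ℝ ι, exp
        (-U (ω + (ψ₀ + s • n))) * (p (ω + (ψ₀ + s • n)) * q (ω + (ψ₀ + s • n)) * r (ω + (ψ₀ + s • n)) * w (ω + (ψ₀ + s • n))) ∂(multivariateGaussian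
        0 Γ)))
      ((∫ ω : EuclideanSpace ℝ ι, exp (-U (ω + ψ₀)) ∂(multivariateGaussian 0 Γ))⁻¹ *
        ((∫ ω : EuclideanSpace ℝ ι, exp (-U (ω + ψ₀)) * (p' (ω + ψ₀) n * q (ω + ψ₀) * r (ω + ψ₀) * w (ω + ψ₀)) ∂(multivariateGaussian 0 Γ)) +
          (∫ ω : EuclideanSpace ℝ ι, exp (-U (ω + ψ₀)) * (p (ω + ψ₀) * q' (ω + ψ₀) n * r (ω + ψ₀) * w (ω + ψ₀)) ∂(multivariateGaussian 0 Γ)) +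
          (∫ ω : EuclideanSpace ℝ ι, exp (-U (ω + ψ₀)) * (p (ω + ψ₀) * q (ω + ψ₀) * r' (ω + ψ₀) n * w (ω + ψ₀)) ∂(multivariateGaussian 0 Γ)) +
          (∫ ω : EuclideanSpace ℝ ι, exp (-U (ω + ψ₀)) * (p (ω + ψ₀) * q (ω + ψ₀) * r (ω + ψ₀) * w' (ω + ψ₀) n) ∂(multivariateGaussian 0 Γ))) -
        ((∫ ω : EuclideanSpace ℝ ι, exp (-U (ω + ψ₀)) ∂(multivariateGaussian 0 Γ))⁻¹ * (∫ ω : EuclideanSpace ℝ ι, exp (-U (ω + ψ₀)) * (p (ω + ψ₀) * q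
            (ω + ψ₀) * r (ω + ψ₀) * w (ω + ψ₀) * U' (ω + ψ₀) n) ∂(multivariateGaussian 0 Γ)) -
          ((∫ ω : EuclideanSpace ℝ ι, exp (-U (ω + ψ₀)) ∂(multivariateGaussian 0 Γ)) ^ 2)⁻¹ * ((∫ ω : EuclideanSpace ℝ ι, exp (-U (ω + ψ₀)) * (p (ω +
              ψ₀) * q (ω + ψ₀) * r (ω + ψ₀) * w (ω + ψ₀)) ∂(multivariateGaussian 0 Γ)) * (∫ ω : EuclideanSpace ℝ ι, exp (-U (ω + ψ₀)) * U' (ω + ψ₀) n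
              ∂(multivariateGaussian 0 Γ))))) 0 := by
  have hpc : Continuous p := continuous_iff_continuousAt.2 fun φ => (hp φ).continuousAt
  have hqc : Continuous q := continuous_iff_continuousAt.2 fun φ => (hq φ).continuousAt
  have hrc : Continuous r := continuous_iff_continuousAt.2 fun φ => (hr φ).continuousAt
  have hwc : Continuous w := continuous_iff_continuousAt.2 fun φ => (hw φ).continuousAt
  have hM := hasDerivAt_tilted_mean_line (p := fun φ => p φ * q φ * r φ * w φ) (p' := fun φ => (p φ * q φ * r φ) • w' φ + w φ • ((p φ * q φ) • r' φ +
      r φ • (p φ • q' φ + q φ • p' φ)))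
    (Cp := 2 * (2 * (2 * Cp * Cq) * Cr) * Cw) (np := np + nq + nr + nw) hΓ hΓop Y hUd hU'd hκ₀ hκ₁ ha hτ hδ hθ0 hθ1 hκθ hstab hU'b hU''b (fun φ =>
        ((((hp φ).mul (hq φ)).mul (hr φ)).mul (hw φ)))
    (((((hpc.mul hqc).mul hrc)).smul hw'c).add (hwc.smul ((((hpc.mul hqc)).smul hr'c).add (hrc.smul (class_mul_fderiv_continuous hp hp'c hq hq'c)))))
    (fun φ => class_mul_abs_le (fun φ => class_mul_abs_le (fun φ => class_mul_abs_le hpb hqb φ) hrb φ) hwb φ)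
    (fun φ => class_mul_fderiv_le (p := fun φ => p φ * q φ * r φ) (p' := fun φ => (p φ * q φ) • r' φ + r φ • (p φ • q' φ + q φ • p' φ)) (fun φ =>
        class_mul_abs_le (fun φ => class_mul_abs_le hpb hqb φ) hrb φ)
      (fun φ => class_mul_fderiv_le (p := fun φ => p φ * q φ) (p' := fun φ => p φ • q' φ + q φ • p' φ) (fun φ => class_mul_abs_le hpb hqb φ)
      (fun φ => class_mul_fderiv_le hpb hp'b hqb hq'b φ) hrb hr'b φ) hwb hw'b φ) ψ₀ n
  have i_pdqrw := integrable_tilted_of_growth (p := fun φ => p' φ n * q φ * r φ * w φ) hΓ hΓop Y hUd ((((hp'c.clm_apply continuous_const).mul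
      hqc).mul hrc).mul hwc) hκ₀ hκ₁ ha hτ hδ hθ1 hκθ hstab hU'b
    (fun φ => class_mul_abs_le (fun φ => class_mul_abs_le (fun φ => class_mul_abs_le (fun φ => class_apply_abs_le hp'b φ n) hqb φ) hrb φ) hwb φ) ψ₀
  have i_pqdrw := integrable_tilted_of_growth (p := fun φ => p φ * q' φ n * r φ * w φ) hΓ hΓop Y hUd (((hpc.mul (hq'c.clm_apply
      continuous_const)).mul hrc).mul hwc) hκ₀ hκ₁ ha hτ hδ hθ1 hκθ hstab hU'b
    (fun φ => class_mul_abs_le (fun φ => class_mul_abs_le (fun φ => class_mul_abs_le hpb (fun φ => class_apply_abs_le hq'b φ n) φ) hrb φ) hwb φ) ψ₀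
  have i_pqrdw := integrable_tilted_of_growth (p := fun φ => p φ * q φ * r' φ n * w φ) hΓ hΓop Y hUd (((hpc.mul hqc).mul (hr'c.clm_apply
      continuous_const)).mul hwc) hκ₀ hκ₁ ha hτ hδ hθ1 hκθ hstab hU'b
    (fun φ => class_mul_abs_le (fun φ => class_mul_abs_le (fun φ => class_mul_abs_le hpb hqb φ) (fun φ => class_apply_abs_le hr'b φ n) φ) hwb φ) ψ₀
  have i_pqrwd := integrable_tilted_of_growth (p := fun φ => p φ * q φ * r φ * w' φ n) hΓ hΓop Y hUd (((hpc.mul hqc).mul hrc).mul (hw'c.clm_apply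
      continuous_const)) hκ₀ hκ₁ ha hτ hδ hθ1 hκθ hstab hU'b
    (fun φ => class_mul_abs_le (fun φ => class_mul_abs_le (fun φ => class_mul_abs_le hpb hqb φ) hrb φ) (fun φ => class_apply_abs_le hw'b φ n) φ) ψ₀
  have is2 : Integrable (fun ω : EuclideanSpace ℝ ι => exp (-U (ω + ψ₀)) * (p' (ω + ψ₀) n * q (ω + ψ₀) * r (ω + ψ₀) * w (ω + ψ₀)) + exp (-U (ω + ψ₀))
      * (p (ω + ψ₀) * q' (ω + ψ₀) n * r (ω + ψ₀) * w (ω + ψ₀))) (multivariateGaussian 0 Γ) := i_pdqrw.add i_pqdrw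
  have is3 : Integrable (fun ω : EuclideanSpace ℝ ι => exp (-U (ω + ψ₀)) * (p' (ω + ψ₀) n * q (ω + ψ₀) * r (ω + ψ₀) * w (ω + ψ₀)) + exp (-U (ω + ψ₀))
      * (p (ω + ψ₀) * q' (ω + ψ₀) n * r (ω + ψ₀) * w (ω + ψ₀)) + exp (-U (ω + ψ₀)) * (p (ω + ψ₀) * q (ω + ψ₀) * r' (ω + ψ₀) n * w (ω + ψ₀)))
      (multivariateGaussian 0 Γ) := is2.add i_pqrdw
  have esplit : (∫ ω : EuclideanSpace ℝ ι, exp (-U (ω + ψ₀)) * ((p (ω + ψ₀) * q (ω + ψ₀) * r (ω + ψ₀)) • w' (ω + ψ₀) + w (ω + ψ₀) • ((p (ω + ψ₀) * q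
      (ω + ψ₀)) • r' (ω + ψ₀) + r (ω + ψ₀) • (p (ω + ψ₀) • q' (ω + ψ₀) + q (ω + ψ₀) • p' (ω + ψ₀)))) n ∂(multivariateGaussian 0 Γ)) =
      (∫ ω : EuclideanSpace ℝ ι, exp (-U (ω + ψ₀)) * (p' (ω + ψ₀) n * q (ω + ψ₀) * r (ω + ψ₀) * w (ω + ψ₀)) ∂(multivariateGaussian 0 Γ)) +
        (∫ ω : EuclideanSpace ℝ ι, exp (-U (ω + ψ₀)) * (p (ω + ψ₀) * q' (ω + ψ₀) n * r (ω + ψ₀) * w (ω + ψ₀)) ∂(multivariateGaussian 0 Γ)) +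
        (∫ ω : EuclideanSpace ℝ ι, exp (-U (ω + ψ₀)) * (p (ω + ψ₀) * q (ω + ψ₀) * r' (ω + ψ₀) n * w (ω + ψ₀)) ∂(multivariateGaussian 0 Γ)) +
        (∫ ω : EuclideanSpace ℝ ι, exp (-U (ω + ψ₀)) * (p (ω + ψ₀) * q (ω + ψ₀) * r (ω + ψ₀) * w' (ω + ψ₀) n) ∂(multivariateGaussian 0 Γ)) := by
    rw [← integral_add i_pdqrw i_pqdrw, ← integral_add is2 i_pqrdw, ← integral_add is3 i_pqrwd]
    exact integral_congr_ae (ae_of_all _ fun ω => by simp only [_root_.add_apply, _root_.smul_apply, smul_eq_mul]; ring)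
  rw [esplit] at hM
  exact hM

/-! ## Toy -/

/-- Toy (RULE 1 for a constant observable in numbers): `d∕ds 1 = 0`. -/
example : HasDerivAt (fun _ : ℝ => (1 : ℝ)) 0 0 := hasDerivAt_const 0 1

end Summit.QuantumFields.BalabanUV.T4Continuum.NE7b.SupTiltedProductMeanLines

end
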